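import Mathlib
import Summits.Ventures.HodgeRepro2.T5AdicCompletionLocalField
import Summits.Ventures.HodgeRepro2.T5AdicCompletionGaloisInvariance
import Summits.Ventures.HodgeRepro2.T5AdicCompletionConductor

/-!
# Mathlib's completion `Kv` is a locally compact field; closed balls are compact; `Kvˣ` is locally compact

FOUNDATIONS for the N4 / N5 lanes (the hypotheses «locally compact, Hausdorff, totally disconnected,
first countable» that route/T5-LEAN-p7.md / LEAN-ANNEX-p8's van Dantzig statements take on the
local groups): `Kv = v.adicCompletion K` has the compact open unit ball `O_Kv`
(`T5AdicCompletionGaloisInvariance.isCompact_adicCompletionIntegers`, `Valued.isOpen_valuationSubring`),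
hence is a LOCALLY COMPACT topological field (`instance locallyCompactSpace`), a PROPER metric space
(`instance properSpace`), every closed ball `{x | v x ≤ exp k}` is compact
(`isCompact_setOf_val_le_exp`), and its unit group `Kvˣ` (open in `Kv`) is locally compact
(`instance locallyCompactSpace_units`).  Hausdorff / totally disconnected / first countable were
already available by instance search (the ultrametric normed-field structure of rows 75 / 80).

Declaration per README §8(d): «uses an L-value-free non-vanishing device: NO».
-/

namespace Summit.Ventures.HodgeRepro2.T5AdicCompletionLocallyCompact

open IsDedekindDomain HeightOneSpectrum WithZero

variable {K : Type*} [Field K] [NumberField K] (v : HeightOneSpectrum (NumberField.RingOfIntegers K))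

/-- `O_Kv` is open in `Kv`. -/
theorem isOpen_adicCompletionIntegers : IsOpen (adicCompletionIntegers K v : Set (adicCompletion K v)) :=
  Valued.isOpen_valuationSubring _

/-- `O_Kv` is a neighbourhood of `0`. -/
theorem adicCompletionIntegers_mem_nhds_zero :
    (adicCompletionIntegers K v : Set (adicCompletion K v)) ∈ nhds (0 : adicCompletion K v) :=
  (isOpen_adicCompletionIntegers v).mem_nhds (adicCompletionIntegers K v).zero_mem

/-- `Kv` IS LOCALLY COMPACT (a compact open subring). -/
instance locallyCompactSpace : LocallyCompactSpace (adicCompletion K v) :=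
  (T5AdicCompletionGaloisInvariance.isCompact_adicCompletionIntegers v).locallyCompactSpace_of_mem_nhds_of_addGroup
    (adicCompletionIntegers_mem_nhds_zero v)

/-- `Kv` IS A PROPER METRIC SPACE (closed balls are compact), with the normed-field structure of
row 75. -/
instance properSpace : ProperSpace (adicCompletion K v) :=
  ProperSpace.of_locallyCompactSpace (adicCompletion K v)

/-- The closed ball `{x | v x ≤ exp k}` is `ϖ^{−k} · O_Kv`, hence compact. -/
theorem isCompact_setOf_val_le_exp (k : ℤ) : IsCompact {x : adicCompletion K v | Valued.v x ≤ exp k} := by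
  obtain ⟨ϖ, hϖ⟩ := IsDiscreteValuationRing.exists_irreducible (adicCompletionIntegers K v)
  have hϖv : Valued.v (ϖ : adicCompletion K v) = exp (-1) :=
    (T5AdicCompletionConductor.irreducible_iff_val_eq_exp_neg_one v ϖ).mp hϖ
  have hϖ0 : (ϖ : adicCompletion K v) ≠ 0 := by
    intro h; rw [h, map_zero] at hϖv; exact exp_ne_zero hϖv.symm
  set c : adicCompletion K v := (ϖ : adicCompletion K v) ^ (-k) with hc
  have hc0 : c ≠ 0 := zpow_ne_zero _ hϖ0
  have hcv : Valued.v c = exp k := by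
    rw [hc, map_zpow₀, hϖv, ← exp_zsmul, smul_neg, smul_eq_mul, mul_one, neg_neg]
  have : {x : adicCompletion K v | Valued.v x ≤ exp k} =
      (fun y => c * y) '' (adicCompletionIntegers K v : Set (adicCompletion K v)) := by
    ext x
    simp only [Set.mem_setOf_eq, Set.mem_image, SetLike.mem_coe, mem_adicCompletionIntegers]
    constructor
    · intro hx
      refine ⟨c⁻¹ * x, ?_, by rw [← mul_assoc, mul_inv_cancel₀ hc0, one_mul]⟩
      rw [map_mul, map_inv₀, hcv]
      calc (exp k)⁻¹ * Valued.v x ≤ (exp k)⁻¹ * exp k := mul_le_mul' le_rfl hx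
        _ = 1 := inv_mul_cancel₀ exp_ne_zero
    · rintro ⟨y, hy, rfl⟩
      rw [map_mul, hcv]
      calc exp k * Valued.v y ≤ exp k * 1 := mul_le_mul' le_rfl hy
        _ = exp k := mul_one _
  rw [this]
  exact (T5AdicCompletionGaloisInvariance.isCompact_adicCompletionIntegers v).image (continuous_const.mul continuous_id)

/-- `Kvˣ` IS LOCALLY COMPACT (open in the complete normed field `Kv`). -/
instance locallyCompactSpace_units : LocallyCompactSpace (adicCompletion K v)ˣ :=
  (Units.isOpenEmbedding_val (R := adicCompletion K v)).locallyCompactSpace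

end Summit.Ventures.HodgeRepro2.T5AdicCompletionLocallyCompact
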